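import Literature.NumberTheory.Sieve.CFSemigroupHensley
import HarnessLib

/-!
# The critical exponent of the continued-fractions semigroup is `δ_A`

Support file (all results proved) for the named fact
`Literature.NumberTheory.Sieve.MageeOhWinter2019_uniformCounting` (`CFSemigroupCounting.lean`).
In [MageeOhWinter2019] the exponent `2δ` of the count `#(Γ ∩ B_R) ~ c R^{2δ}` is the Hausdorff
dimension of the limit set (§1) and the zero of the pressure (§2.2); classically it is also the
**critical exponent** of the semigroup, the abscissa of convergence of its Poincaré series
`Σ_{γ ∈ Γ} ‖γ‖^{-2s}`. For `Γ_A` we prove this identification from the Gibbs bounds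
`e^{nP_A(s)} ≤ Z_n(s) ≤ 4^s e^{nP_A(s)}` (`CFSemigroupPressure.lean`) and Bowen's formula
`P_A(δ_A) = 0` (`CFSemigroupBowen.lean`):

* `summable_words_iff`: `Σ_{w ∈ A^*} q(w)^{-2s} < ∞ ↔ δ_A < s` (`s ≥ 0`);
* `summable_cfSemigroup_iff`: `Σ_{γ ∈ Γ_A} ‖γ‖_F^{-2s} < ∞ ↔ δ_A < s` (`s ≥ 0`) — the critical
  exponent of `Γ_A` (for the Frobenius norm) is `δ_A = dim_H Λ(Γ_A)`.

## References

* M. Magee, H. Oh, D. Winter, J. reine angew. Math. 753 (2019) 89–135, §1–§2.2.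
  [MageeOhWinter2019]
* S. J. Patterson, *The limit set of a Fuchsian group*, Acta Math. 136 (1976) 241–273 (critical
  exponent and dimension).
-/

noncomputable section

open Filter Set
open scoped Classical MatrixGroups

namespace Literature.NumberTheory.Sieve

variable {A : Finset ℕ}

/-! ### The Poincaré series over words -/

/-- **Convergence above `δ_A`:** for `s > δ_A` the series `Σ_{w ∈ A^*} q(w)^{-2s}` converges
(`Z_n(s) ≤ 4^s e^{n P_A(s)}` with `P_A(s) < 0`). [cite: MageeOhWinter2019, §2.2] -/
theorem summable_words_of_lt (hA : ∀ a ∈ A, 1 ≤ a) (h2 : 2 ≤ A.card) {s : ℝ}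
    (hs : cfDimension A < s) :
    Summable fun x : Σ n : ℕ, (Fin n → A) => ((((cfQ fun i => (x.2 i : ℕ)) : ℝ)) ^ 2) ^ (-s) := by
  have hne := nonempty_of_two_le_card h2
  have hδ := cfDimension_pos hA h2
  have hs0 : 0 ≤ s := hδ.le.trans hs.le
  rw [cfDimension_eq_cfPressureZero hA h2] at hs
  have hP : cfPressure A s < 0 := cfPressure_neg_of_lt hA h2 hs
  have hnn : ∀ x : Σ n : ℕ, (Fin n → A), 0 ≤ ((((cfQ fun i => (x.2 i : ℕ)) : ℝ)) ^ 2) ^ (-s) :=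
    fun x => Real.rpow_nonneg (sq_nonneg _) _
  -- summable over each fibre, with fibre sums `Z_n(s) ≤ 4^s r^n`, `r = e^{P(s)} < 1`
  refine (summable_sigma_of_nonneg hnn).2 ⟨fun n => (hasSum_fintype _).summable, ?_⟩
  have hfib : ∀ n : ℕ, ∑' w : Fin n → A, ((((cfQ fun i => (w i : ℕ)) : ℝ)) ^ 2) ^ (-s) = cfPartition A n s :=
    fun n => by rw [tsum_fintype]; rfl
  simp only [hfib]
  refine Summable.of_nonneg_of_le (fun n => (cfPartition_pos hA hne n s).le)
    (fun n => cfPartition_le_exp hA hne hs0 n) ?_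
  have hr : Real.exp (cfPressure A s) < 1 := by simpa using Real.exp_lt_exp.2 hP
  have hgeom := summable_geometric_of_lt_one (Real.exp_pos _).le hr
  refine (hgeom.mul_left ((4 : ℝ) ^ s)).congr fun n => ?_
  rw [← Real.exp_nat_mul]

/-- **Divergence at and below `δ_A`:** for `0 ≤ s ≤ δ_A` the series `Σ_{w ∈ A^*} q(w)^{-2s}` diverges
(`Z_n(s) ≥ 1` for every `n`). [cite: MageeOhWinter2019, §2.2] -/
theorem not_summable_words_of_le (hA : ∀ a ∈ A, 1 ≤ a) (h2 : 2 ≤ A.card) {s : ℝ} (hs0 : 0 ≤ s)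
    (hs : s ≤ cfDimension A) :
    ¬ Summable fun x : Σ n : ℕ, (Fin n → A) => ((((cfQ fun i => (x.2 i : ℕ)) : ℝ)) ^ 2) ^ (-s) := by
  intro hsum
  have hnn : ∀ x : Σ n : ℕ, (Fin n → A), 0 ≤ ((((cfQ fun i => (x.2 i : ℕ)) : ℝ)) ^ 2) ^ (-s) :=
    fun x => Real.rpow_nonneg (sq_nonneg _) _
  obtain ⟨-, hfibsum⟩ := (summable_sigma_of_nonneg hnn).1 hsum
  have hfib : ∀ n : ℕ, ∑' w : Fin n → A, ((((cfQ fun i => (w i : ℕ)) : ℝ)) ^ 2) ^ (-s) = cfPartition A n s :=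
    fun n => by rw [tsum_fintype]; rfl
  simp only [hfib] at hfibsum
  rw [cfDimension_eq_cfPressureZero hA h2] at hs
  have hone : ∀ n, (1 : ℝ) ≤ cfPartition A n s := one_le_cfPartition_of_le hA h2 hs0 hs
  -- a summable sequence tends to `0`, but ours is `≥ 1`
  have h0 := hfibsum.tendsto_atTop_zero
  have h1 : (1 : ℝ) ≤ 0 := ge_of_tendsto' h0 hone
  linarith

/-- **`δ_A` is the abscissa of convergence of the Poincaré series over words:**
`Σ_{w ∈ A^*} q(w)^{-2s} < ∞ ↔ δ_A < s` for `s ≥ 0`. [cite: MageeOhWinter2019, §2.2] -/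
theorem summable_words_iff (hA : ∀ a ∈ A, 1 ≤ a) (h2 : 2 ≤ A.card) {s : ℝ} (hs0 : 0 ≤ s) :
    (Summable fun x : Σ n : ℕ, (Fin n → A) => ((((cfQ fun i => (x.2 i : ℕ)) : ℝ)) ^ 2) ^ (-s)) ↔
      cfDimension A < s := by
  constructor
  · intro h
    by_contra hle
    push Not at hle
    exact not_summable_words_of_le hA h2 hs0 hle h
  · exact summable_words_of_lt hA h2

/-! ### The Poincaré series over the semigroup -/

/-- The even nonempty words over `A`. [folklore] -/
abbrev cfEvenWords (A : Finset ℕ) : Type := {x : Σ n : ℕ, (Fin n → A) // Even x.1 ∧ x.1 ≠ 0}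

/-- The elements of `Γ_A`, as a subtype of `SL₂(ℤ)`. [cite: MageeOhWinter2019, §1] -/
abbrev cfElements (A : Finset ℕ) : Type := {γ : SL(2, ℤ) // (γ : Matrix (Fin 2) (Fin 2) ℤ) ∈ cfSemigroup A}

/-- A digit sequence all of whose digits lie in `A`, extending a finite word. [folklore] -/
def cfFill (hne : A.Nonempty) {n : ℕ} (w : Fin n → A) : ℕ → ℕ :=
  fun i => if h : i < n then ((w ⟨i, h⟩ : A) : ℕ) else hne.choose

/-- The filled digits lie in `A`. [folklore] -/
theorem cfFill_mem (hne : A.Nonempty) {n : ℕ} (w : Fin n → A) (i : ℕ) : cfFill hne w i ∈ A := by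
  unfold cfFill
  split_ifs with h
  · exact (w _).2
  · exact hne.choose_spec

/-- The filled digits agree with the word below its length. [folklore] -/
theorem cfWord_cfFill (hne : A.Nonempty) {n : ℕ} (w : Fin n → A) :
    cfWord (cfFill hne w) n = cfMat fun i => (w i : ℕ) :=
  cfWord_congr fun i hi => by rw [cfExt_of_lt _ hi]; simp [cfFill, hi]

/-- The word-to-element map `w ↦ M_w ∈ Γ_A` on even nonempty words. [folklore] -/
def cfToElement (hne : A.Nonempty) (x : cfEvenWords A) : cfElements A :=
  ⟨⟨cfWord (cfFill hne x.1.2) x.1.1, by rw [det_cfWord, x.2.1.neg_one_pow]⟩,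
    cfWord_mem_cfSemigroup (cfFill_mem hne x.1.2) x.2.2 x.2.1⟩

/-- **Words ↔ elements:** `w ↦ M_w` is a bijection from even nonempty words onto `Γ_A`
(freeness, `cfWord_injective`, and the definition of `Γ_A`). [cite: MageeOhWinter2019, §2.1 II] -/
theorem cfToElement_bijective (hA : ∀ a ∈ A, 1 ≤ a) (hne : A.Nonempty) :
    Function.Bijective (cfToElement (A := A) hne) := by
  constructor
  · rintro ⟨⟨n, w⟩, hw⟩ ⟨⟨n', w'⟩, hw'⟩ h
    have hmat : cfWord (cfFill hne w) n = cfWord (cfFill hne w') n' :=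
      congrArg (fun e : cfElements A => ((e.1 : SL(2, ℤ)) : Matrix (Fin 2) (Fin 2) ℤ)) h
    obtain ⟨hn, hdig⟩ := cfWord_injective (fun i => hA _ (cfFill_mem hne w i))
      (fun i => hA _ (cfFill_mem hne w' i)) hmat
    subst hn
    have hww : w = w' := by
      funext i
      apply Subtype.ext
      have := hdig i i.2
      simpa [cfFill, i.2] using this
    subst hww
    rfl
  · rintro ⟨γ, hγ⟩
    obtain ⟨w, hw0, hweven, hwA, hprod⟩ := hγ
    have hin : ∀ i < w.length, w.getD i 1 ∈ A := fun i hi => by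
      rw [List.getD_eq_getElem _ _ hi]
      exact hwA _ (List.getElem_mem hi)
    let v : Fin w.length → A := fun i => ⟨w.getD i 1, hin i i.2⟩
    have hn0 : w.length ≠ 0 := (List.length_pos_iff.2 hw0).ne'
    refine ⟨⟨⟨w.length, v⟩, hweven, hn0⟩, ?_⟩
    apply Subtype.ext
    apply Subtype.ext
    show cfWord (cfFill hne v) w.length = (γ : Matrix (Fin 2) (Fin 2) ℤ)
    rw [← hprod, cfWord_eq_prod]
    congr 1
    congr 1
    conv_rhs => rw [← map_getD_range_eq w]
    refine List.map_congr_left fun i hi => ?_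
    rw [List.mem_range] at hi
    simp [cfFill, hi, v]

/-- The Poincaré weight of an element: `‖γ‖_F^{-2s} = (Σ γᵢⱼ²)^{-s}`. [cite: MageeOhWinter2019, §1] -/
def cfPoincareWt (s : ℝ) (γ : cfElements A) : ℝ :=
  (∑ i, ∑ j, ((((γ.1 : SL(2, ℤ)) : Matrix (Fin 2) (Fin 2) ℤ) i j : ℤ) : ℝ) ^ 2) ^ (-s)

/-- Comparison of the weights along the bijection: `4^{-s} q^{-2s} ≤ ‖M_w‖^{-2s} ≤ q^{-2s}`
(`q² ≤ ‖M_w‖² ≤ 4q²`). [folklore] -/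
theorem cfPoincareWt_cfToElement_mem (hA : ∀ a ∈ A, 1 ≤ a) (hne : A.Nonempty) {s : ℝ} (hs : 0 ≤ s)
    (x : cfEvenWords A) :
    cfPoincareWt s (cfToElement hne x) ∈
      Icc ((4 : ℝ) ^ (-s) * ((((cfQ fun i => (x.1.2 i : ℕ)) : ℝ)) ^ 2) ^ (-s))
        (((((cfQ fun i => (x.1.2 i : ℕ)) : ℝ)) ^ 2) ^ (-s)) := by
  obtain ⟨⟨n, w⟩, heven, hn0⟩ := x
  obtain ⟨m, rfl⟩ := Nat.exists_eq_succ_of_ne_zero hn0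
  have hd : ∀ i, 1 ≤ cfFill hne w i := fun i => hA _ (cfFill_mem hne w i)
  have hq : ((cfQ fun i => (w i : ℕ)) : ℝ) = cfDen (cfFill hne w) (m + 1) := by
    rw [cfQ_eq, ← cfWord_cfFill hne w]
    rfl
  have hq1 : (1 : ℝ) ≤ cfDen (cfFill hne w) (m + 1) := by exact_mod_cast one_le_cfDen hd _
  have hup := normSq_cfWord_le hd m
  have hlow := sq_cfDen_le_normSq (cfFill hne w) (m + 1)
  have hqpos : (0 : ℝ) < ((cfDen (cfFill hne w) (m + 1) : ℤ) : ℝ) ^ 2 := pow_pos (by linarith) 2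
  have hnpos := lt_of_lt_of_le hqpos hlow
  show (∑ i, ∑ j, (((cfWord (cfFill hne w) (m + 1) i j : ℤ) : ℝ)) ^ 2) ^ (-s) ∈ _
  rw [hq]
  constructor
  · rw [← Real.mul_rpow (by norm_num) hqpos.le]
    exact Real.rpow_le_rpow_of_nonpos hnpos hup (by linarith)
  · exact Real.rpow_le_rpow_of_nonpos hqpos hlow (by linarith)

/-- **The critical exponent of `Γ_A` is `δ_A`:** for `s ≥ 0` the Poincaré series
`Σ_{γ ∈ Γ_A} ‖γ‖_F^{-2s}` converges if and only if `s > δ_A = dim_H Λ(Γ_A)`.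
[cite: MageeOhWinter2019, §1 and §2.2] -/
theorem summable_cfSemigroup_iff (hA : ∀ a ∈ A, 1 ≤ a) (h2 : 2 ≤ A.card) {s : ℝ} (hs0 : 0 ≤ s) :
    Summable (cfPoincareWt (A := A) s) ↔ cfDimension A < s := by
  have hne := nonempty_of_two_le_card h2
  have htrans : Summable (cfPoincareWt (A := A) s) ↔
      Summable fun x : cfEvenWords A => cfPoincareWt s (cfToElement hne x) :=
    (Equiv.ofBijective (cfToElement hne) (cfToElement_bijective hA hne)).summable_iff.symm
  rw [htrans]
  have hWnn : ∀ x : Σ n : ℕ, (Fin n → A), 0 ≤ ((((cfQ fun i => (x.2 i : ℕ)) : ℝ)) ^ 2) ^ (-s) :=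
    fun x => Real.rpow_nonneg (sq_nonneg _) _
  constructor
  · intro hsum
    by_contra hle
    push Not at hle
    -- the even-word subseries of `Σ q^{-2s}` converges
    have hsub : Summable fun x : cfEvenWords A => ((((cfQ fun i => (x.1.2 i : ℕ)) : ℝ)) ^ 2) ^ (-s) := by
      refine Summable.of_nonneg_of_le (fun x => hWnn x.1) (fun x => ?_) (hsum.mul_left ((4 : ℝ) ^ s))
      have h := (cfPoincareWt_cfToElement_mem hA hne hs0 x).1
      have h4 : (4 : ℝ) ^ s * (4 : ℝ) ^ (-s) = 1 := by
        rw [← Real.rpow_add (by norm_num)]; simp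
      calc ((((cfQ fun i => (x.1.2 i : ℕ)) : ℝ)) ^ 2) ^ (-s)
          = (4 : ℝ) ^ s * ((4 : ℝ) ^ (-s) * ((((cfQ fun i => (x.1.2 i : ℕ)) : ℝ)) ^ 2) ^ (-s)) := by
            rw [← mul_assoc, h4, one_mul]
        _ ≤ (4 : ℝ) ^ s * cfPoincareWt s (cfToElement hne x) := mul_le_mul_of_nonneg_left h (by positivity)
    -- but the blocks of even length `2(k+1)` each have sum `Z_{2(k+1)}(s) ≥ 1`
    rw [cfDimension_eq_cfPressureZero hA h2] at hle
    have hone : ∀ n, (1 : ℝ) ≤ cfPartition A n s := one_le_cfPartition_of_le hA h2 hs0 hle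
    obtain ⟨ι, hι_def⟩ : ∃ ι : (Σ k : ℕ, (Fin (2 * (k + 1)) → A)) → cfEvenWords A,
        ∀ p, ι p = ⟨⟨2 * (p.1 + 1), p.2⟩, ⟨p.1 + 1, by ring⟩, (Nat.mul_pos two_pos (Nat.succ_pos _)).ne'⟩ :=
      ⟨_, fun p => rfl⟩
    have hinj : Function.Injective ι := by
      rintro ⟨k, w⟩ ⟨k', w'⟩ h
      rw [hι_def, hι_def] at h
      have h1 : 2 * (k + 1) = 2 * (k' + 1) := congrArg (fun z : cfEvenWords A => z.1.1) h
      have hk : k = k' := by omega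
      subst hk
      have h2' : (⟨2 * (k + 1), w⟩ : Σ n : ℕ, (Fin n → A)) = ⟨2 * (k + 1), w'⟩ := congrArg Subtype.val h
      rw [Sigma.mk.inj_iff] at h2'
      obtain ⟨-, hw⟩ := h2'
      have hw' : w = w' := eq_of_heq hw
      subst hw'
      rfl
    have hι : Summable fun p : Σ k : ℕ, (Fin (2 * (k + 1)) → A) =>
        ((((cfQ fun i => (p.2 i : ℕ)) : ℝ)) ^ 2) ^ (-s) :=
      (hsub.comp_injective hinj).congr fun p => by rw [Function.comp_apply, hι_def]
    obtain ⟨-, hfib⟩ := (summable_sigma_of_nonneg fun p => Real.rpow_nonneg (sq_nonneg _) _).1 hι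
    have hblock : ∀ k : ℕ, (1 : ℝ) ≤ ∑' w : Fin (2 * (k + 1)) → A,
        ((((cfQ fun i => (w i : ℕ)) : ℝ)) ^ 2) ^ (-s) := by
      intro k
      rw [tsum_fintype]
      exact hone _
    have h0 := hfib.tendsto_atTop_zero
    have h1 : (1 : ℝ) ≤ 0 := ge_of_tendsto' h0 hblock
    linarith
  · intro hlt
    have hsum := summable_words_of_lt hA h2 hlt
    have hsub : Summable fun x : cfEvenWords A => ((((cfQ fun i => (x.1.2 i : ℕ)) : ℝ)) ^ 2) ^ (-s) :=
      hsum.comp_injective Subtype.val_injective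
    exact Summable.of_nonneg_of_le (fun x => Real.rpow_nonneg (Finset.sum_nonneg fun _ _ =>
      Finset.sum_nonneg fun _ _ => sq_nonneg _) _)
      (fun x => (cfPoincareWt_cfToElement_mem hA hne hs0 x).2) hsub

end Literature.NumberTheory.Sieve
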